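import Summits.AtomisticToContinuum.Crystallization.Theorems.FrustratedLawDichotomyStrainedPatchHomValueT2Kit

/-!
# The CENTRE GUARD of the G5′ value leaf: `cenGuard c` (Frobenius distance of the box-centre entries from the identity `≤ 1/4`, exact integers) and
# ★ `norm_cenMap_sub_one_le` — it implies `‖cenMap c − 1‖ ≤ 1/4`, the hypothesis under which the table leaf certifies the value AT THE CENTRE
# (`…HomValueT2SoundH.valueP_sound`) (27623 `(H) HomFloor`, hcp half; decomp-a2c hand-1 g41; I1-ROADMAP-g41 §3).

One kernel definition + its soundness; 0 sorry; standard axioms; no instances / notation / `#eval`.  `--supports stmt-AtomisticToContinuum-27623`.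
-/

noncomputable section

namespace Summit.AtomisticToContinuum.Crystallization.Theorems.FrustratedLawDichotomyStrainedPatchHomValueT2Kit

open scoped BigOperators
open Literature.Analysis.ValidatedNumerics.Numerics
open Summit.AtomisticToContinuum.Crystallization.Theorems.ChargedEnergyGapNegative (E3)
open Summit.AtomisticToContinuum.Crystallization.Theorems.FrustratedLawDichotomyStrainedPatchHomCurvCentreKit (cenMap cenMap_apply)

/-- The identity entries scaled by `SC`. -/
def idZ (k l : Fin 3) : ℤ := if k = l then (SC : ℤ) else 0

/-- ★ **CENTRE GUARD**: `16 · Σ_{kl} (c_kl − δ_kl·SC)² ≤ SC²` (the Frobenius norm of `U_c − 1` is at most `1/4`). -/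
def cenGuard (c : (Fin 3 × Fin 3) ⊕ Fin 3 → ℤ) : Bool :=
  decide (16 * ∑ k : Fin 3, ∑ l : Fin 3, (c (Sum.inl (k, l)) - idZ k l) ^ 2 ≤ (SC : ℤ) ^ 2)

/-- The entries of `cenMap c − 1`. [formal bookkeeping] -/
theorem cenMap_sub_one_apply (c : (Fin 3 × Fin 3) ⊕ Fin 3 → ℤ) (x : E3) (k : Fin 3) :
    (cenMap c - 1) x k = ∑ l : Fin 3, (((c (Sum.inl (k, l)) - idZ k l : ℤ) : ℝ) / SC) * x l := by
  have hS : (SC : ℝ) ≠ 0 := SC_ne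
  rw [sub_apply, PiLp.sub_apply, cenMap_apply, one_apply_eq_self]
  have hx : x k = ∑ l : Fin 3, ((idZ k l : ℤ) : ℝ) / SC * x l := by
    rw [Finset.sum_eq_single k]
    · simp [idZ, hS]
    · intro l _ hne; simp [idZ, Ne.symm hne]
    · simp
  rw [hx, ← Finset.sum_sub_distrib]
  refine Finset.sum_congr rfl fun l _ => ?_
  push_cast
  ring

/-- ★★ **The guard bounds the operator norm**: `cenGuard c = true ⟹ ‖cenMap c − 1‖ ≤ 1/4`. [folklore: row-wise Cauchy–Schwarz ⟹ op-norm ≤ Frobenius] -/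
theorem norm_cenMap_sub_one_le {c : (Fin 3 × Fin 3) ⊕ Fin 3 → ℤ} (h : cenGuard c = true) : ‖cenMap c - 1‖ ≤ 1 / 4 := by
  have hS : (0 : ℝ) < SC := SC_pos
  simp only [cenGuard, decide_eq_true_eq] at h
  -- real entries and their Frobenius bound
  set a : Fin 3 → Fin 3 → ℝ := fun k l => (((c (Sum.inl (k, l)) - idZ k l : ℤ) : ℝ) / SC) with ha
  have hF : ∑ k : Fin 3, ∑ l : Fin 3, a k l ^ 2 ≤ (1 / 4) ^ 2 := by
    have h' : (16 : ℝ) * ∑ k : Fin 3, ∑ l : Fin 3, (((c (Sum.inl (k, l)) - idZ k l : ℤ) : ℝ)) ^ 2 ≤ (SC : ℝ) ^ 2 := by exact_mod_cast h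
    have e : ∑ k : Fin 3, ∑ l : Fin 3, a k l ^ 2 = (∑ k : Fin 3, ∑ l : Fin 3, (((c (Sum.inl (k, l)) - idZ k l : ℤ) : ℝ)) ^ 2) / (SC : ℝ) ^ 2 := by
      rw [Finset.sum_div]; refine Finset.sum_congr rfl fun k _ => ?_
      rw [Finset.sum_div]; refine Finset.sum_congr rfl fun l _ => ?_
      simp only [ha]; rw [div_pow]
    rw [e, div_le_iff₀ (by positivity)]
    nlinarith
  refine ContinuousLinearMap.opNorm_le_bound _ (by norm_num) fun x => ?_
  -- `‖(U_c − 1) x‖² ≤ F² ‖x‖²`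
  have hsq : ‖(cenMap c - 1) x‖ ^ 2 ≤ (1 / 4) ^ 2 * ‖x‖ ^ 2 := by
    rw [EuclideanSpace.norm_sq_eq, EuclideanSpace.norm_sq_eq]
    have hx2 : ∑ i : Fin 3, ‖x i‖ ^ 2 = ∑ l : Fin 3, x l ^ 2 := Finset.sum_congr rfl fun l _ => by rw [Real.norm_eq_abs, sq_abs]
    rw [hx2]
    calc ∑ k : Fin 3, ‖(cenMap c - 1) x k‖ ^ 2 = ∑ k : Fin 3, (∑ l : Fin 3, a k l * x l) ^ 2 := by
          refine Finset.sum_congr rfl fun k _ => ?_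
          rw [Real.norm_eq_abs, sq_abs, cenMap_sub_one_apply]
      _ ≤ ∑ k : Fin 3, (∑ l : Fin 3, a k l ^ 2) * (∑ l : Fin 3, x l ^ 2) :=
          Finset.sum_le_sum fun k _ => Finset.sum_mul_sq_le_sq_mul_sq Finset.univ (a k) (fun l => x l)
      _ = (∑ k : Fin 3, ∑ l : Fin 3, a k l ^ 2) * ∑ l : Fin 3, x l ^ 2 := by rw [Finset.sum_mul]
      _ ≤ (1 / 4) ^ 2 * ∑ l : Fin 3, x l ^ 2 := mul_le_mul_of_nonneg_right hF (Finset.sum_nonneg fun l _ => sq_nonneg _)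
  have h1 : 0 ≤ ‖(cenMap c - 1) x‖ := norm_nonneg _
  have h2 : 0 ≤ 1 / 4 * ‖x‖ := by positivity
  nlinarith [hsq, h1, h2]

end Summit.AtomisticToContinuum.Crystallization.Theorems.FrustratedLawDichotomyStrainedPatchHomValueT2Kit
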